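import Summits.QuantumFields.YangMills.Theorems.BalabanUVNodesN19CoreKnit
import HarnessLib

/-!
# BalabanUVNodes ∕ N19 core knit — SANITY: the binder set of `N19CoreKnit.core_summable_of_spineNodes` is JOINTLY
# SATISFIABLE with genuine rates `< 1` and a genuinely RUNNING coupling table (toy data; no relation to Bałaban's objects)
# (cell `pub-ymgap`, HUMAN RULING D-0062 Track A, cluster K5 «SpineMatching», seat dag-n19-a; count-neutral)

HONEST FRAMING.  Nothing here concerns Bałaban's renormalisation group, Yang–Mills, a continuum limit or a mass gap.  The
knit `BalabanUVNodesN19CoreKnit.core_summable_of_spineNodes` states YM-DAG node N19 (`Spine.NE7.Core`, NE7 proper — NOT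
PRINTED, NOT PROVED) as an implication from ≈ 45 named binders (the in-edge statements of record N16 `NE3Shape` · N17
`ScaleShiftRate` · N18 `NE5` · N22 `NE9 ∧ FadingMemory`, node U2's displayed inputs, node U3's printed-ingredient bracket,
the term-wise END's format binders, the (2.43)-window size binder, hazard H-U5b-1).  A referee's vacuity audit (A5: «is
the antecedent jointly satisfiable, with the rates pinned below 1?») is answered here IN KERNEL: ONE assignment of ALL
binders at once — the tree's toy carriers and functionals (`T4TowerRateComposition.toyCarriers`, `toyEA`, `toyEB`:
backgrounds enter at rate `q^j`, the coupling history with fading memory `q^{j−i}`, run B shifted by `C₅ q^j`), the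
tree's toy readings (`q^k`, `T4TowerRateDischarge.toy_nodes_hypotheses`), a CONSTANT POSITIVE β-function `β ≡ b` (so
that `ScaleShiftRate 0`, `HistLipschitz 0`, `EventualLowerH b` hold) and the RUNNING coupling table it generates from the
infrared pin, `g K k = (√(gIR⁻² + b·(K − k)))⁻¹` (so that the RG equations (0.20) `1/g_k² = 1/g_{k+1}² + b` hold
LITERALLY and the couplings lie in `]0, gIR]`), one good term per cutoff over a one-point field space with the E-ledger
`range (K+1)` (one domain per scale, multiplicity `1`), trivial other kinds, exact size and constant centres — meets every
binder with `θ₅ = ω = θc = θ₃ = a = q ∈ ]0, 1[`, `θ′ = (1+q)∕2 < 1`, `Λ = 1`, and the knit FIRES: `∃ δ, Spine.NE7.Core …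
δ ∧ Summable δ` for the toy cores.  So the knit's hypothesis list is consistent and its rate letters are genuinely `< 1`
(ref-B's A6 note on rate statements, INBOX l.9049).  [folklore] arithmetic throughout; no `def`; 0 `sorry`.
-/

open Finset MeasureTheory

namespace Summit.QuantumFields.YangMills.BalabanUVNodes.N19CoreKnitSanity

open Literature.MathematicalPhysics.QuantumFieldTheory.Balaban1983to89
open T4OutputRate T4RecentScale T4GoodClassBudget T4CauchySum T4TowerRateComposition T4TowerRateDischarge
open T4EtaRateMin (Readings LocalRate ActionRate NE3Shape)
open T4RateLiaison (GaugeDominated)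
open FlowStep T4CouplingMatching
open Summit.QuantumFields.BalabanUV.T4Continuum.Spine
open Summit.QuantumFields.YangMills.BalabanUVNodes.N19CoreKnit

/-- **THE RUNNING TOY COUPLING TABLE solves the RG equations (0.20) with the constant β-function `b` and is pinned at
`gIR` in the infrared**: `g K k = (√(gIR⁻¹² + b·(K − k)))⁻¹` satisfies `FlowStep.RGEqH K (fun _ _ => b) (g K)`,
`g K K = gIR`, and `0 < g K k ≤ gIR` for `k ≤ K` (`b ≥ 0`, `gIR > 0`). [folklore] -/
theorem toy_running {b gIR : ℝ} (hb : 0 ≤ b) (hgIR : 0 < gIR) :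
    (∀ K, RGEqH K (fun _ _ => b)
        (fun k => (Real.sqrt ((gIR ^ 2)⁻¹ + b * ((K - k : ℕ) : ℝ)))⁻¹)) ∧
      (∀ K, (fun k => (Real.sqrt ((gIR ^ 2)⁻¹ + b * ((K - k : ℕ) : ℝ)))⁻¹) K = gIR) ∧
      (∀ K i, i ≤ K → 0 < (Real.sqrt ((gIR ^ 2)⁻¹ + b * ((K - i : ℕ) : ℝ)))⁻¹ ∧
        (Real.sqrt ((gIR ^ 2)⁻¹ + b * ((K - i : ℕ) : ℝ)))⁻¹ ≤ gIR) := by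
  have hx : ∀ K k : ℕ, 0 < (gIR ^ 2)⁻¹ + b * ((K - k : ℕ) : ℝ) := fun K k =>
    add_pos_of_pos_of_nonneg (inv_pos.mpr (pow_pos hgIR 2)) (mul_nonneg hb (Nat.cast_nonneg _))
  have hsq : Real.sqrt ((gIR ^ 2)⁻¹) = gIR⁻¹ := by rw [Real.sqrt_inv, Real.sqrt_sq hgIR.le]
  refine ⟨fun K k hk => ?_, fun K => ?_, fun K i _ => ⟨inv_pos.mpr (Real.sqrt_pos.mpr (hx K i)), ?_⟩⟩
  · -- (0.20): 1/g_k² = 1/g_{k+1}² + b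
    have e : ((K - k : ℕ) : ℝ) = ((K - (k + 1) : ℕ) : ℝ) + 1 := by
      have : K - k = (K - (k + 1)) + 1 := by omega
      rw [this]; push_cast; ring
    show 1 / ((Real.sqrt ((gIR ^ 2)⁻¹ + b * ((K - k : ℕ) : ℝ)))⁻¹) ^ 2
      = 1 / ((Real.sqrt ((gIR ^ 2)⁻¹ + b * ((K - (k + 1) : ℕ) : ℝ)))⁻¹) ^ 2 + b
    simp only [inv_pow, one_div, inv_inv]
    rw [Real.sq_sqrt (hx K k).le, Real.sq_sqrt (hx K (k + 1)).le, e]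
    ring
  · -- the infrared pin
    show (Real.sqrt ((gIR ^ 2)⁻¹ + b * ((K - K : ℕ) : ℝ)))⁻¹ = gIR
    rw [Nat.sub_self, Nat.cast_zero, mul_zero, add_zero, hsq, inv_inv]
  · -- the box: g ≤ gIR
    have h1 : gIR⁻¹ ≤ Real.sqrt ((gIR ^ 2)⁻¹ + b * ((K - i : ℕ) : ℝ)) := by
      rw [← hsq]
      exact Real.sqrt_le_sqrt (le_add_of_nonneg_right (mul_nonneg hb (Nat.cast_nonneg _)))
    calc (Real.sqrt ((gIR ^ 2)⁻¹ + b * ((K - i : ℕ) : ℝ)))⁻¹ ≤ (gIR⁻¹)⁻¹ :=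
          inv_anti₀ (inv_pos.mpr hgIR) h1
      _ = gIR := inv_inv gIR

/-- **THE CONSTANT β-FUNCTION meets node U2's displayed inputs**: `β ≡ b` has scale-shift rate `0`, history moduli `0`
with fading memory constant `0`, the eventual lower bound `b` from `k₀ = 0`, and the smallness condition holds for every
`θc ≤ 1`. [folklore] -/
theorem toy_beta {b γ θc : ℝ} (hθc : θc ≤ 1) :
    ScaleShiftRate 0 θc γ (fun _ _ => b) ∧ HistLipschitz (fun _ _ => 0) γ (fun _ _ => b) ∧
      T4CouplingMatching.FadingMemory 0 θc (fun _ _ => 0) ∧ EventualLowerH b γ 0 (fun _ _ => b) ∧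
      (0 : ℝ) * ((((0 : ℕ) : ℝ) + 1) * γ ^ 3 + 2 * γ / b) ≤ (1 - θc) / 2 := by
  refine ⟨fun k w _ => by simp, fun k p q _ _ => by simp, fun k i _ => by simp, fun k v _ _ => le_rfl, ?_⟩
  rw [zero_mul]
  linarith

/-- **NON-VACUITY OF THE KNIT `core_summable_of_spineNodes`.**  For any `0 < q < 1`, `0 < b`, `0 < gIR`: the toy
assignment of the module docstring meets ALL binders of `N19CoreKnit.core_summable_of_spineNodes` at once (rates
`θ₅ = ω = θc = θ₃ = a = q`, common rate `θ′ = (1+q)∕2 < 1`, multiplicity base `Λ = 1`, running couplings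
`g K k = (√(gIR⁻² + b(K−k)))⁻¹` of the constant β-function `b` pinned at `gIR`, one good term per cutoff over the
one-point field space, E-ledger `range (K+1)`), and the knit's conclusion holds for the resulting toy cores:
`∃ δ, Spine.NE7.Core 1 1 T ∅ P Q δ ∧ Summable δ`.  Consistency of the binder SET only; no physics. [folklore] -/
theorem spineNodes_nonvacuous {q b gIR : ℝ} (hq0 : 0 < q) (hq1 : q < 1) (hb : 0 < b) (hgIR : 0 < gIR) :
    ∃ δ : ℕ → ℝ, NE7.Core (ι := Unit) 1 1 (fun _ => Finset.univ) (fun _ _ => ∅)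
        (fun K _ _ => ∫ _v, (∏ X ∈ range (K + 1),
          Real.exp (toyEA q q (fun k => (Real.sqrt ((gIR ^ 2)⁻¹ + b * ((K - k : ℕ) : ℝ)))⁻¹) (q ^ K) X
            - toyEA q q (fun k => (Real.sqrt ((gIR ^ 2)⁻¹ + b * ((K - k : ℕ) : ℝ)))⁻¹) 0 X)) * 1
          ∂(Measure.dirac ()))
        (fun K _ _ => ∫ _v, (∏ X ∈ range (K + 1),
          Real.exp (toyEB q q 0 (fun i => (Real.sqrt ((gIR ^ 2)⁻¹ + b * ((K + 1 - (i + 1) : ℕ) : ℝ)))⁻¹) (q ^ (K + 1)) X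
            - toyEB q q 0 (fun i => (Real.sqrt ((gIR ^ 2)⁻¹ + b * ((K + 1 - (i + 1) : ℕ) : ℝ)))⁻¹) 0 X)) * 1
          ∂(Measure.dirac ()))
        δ ∧ Summable δ := by
  -- the tree's toy node shapes (NE9, fading memory, Lipschitz-in-U, NE5; NE3's local rate, gauge domination, growth)
  obtain ⟨h9, hΛ, hU, h5⟩ := toy_nonvacuous (C₅ := 0) hq0.le hq1.le hq0.le le_rfl
  obtain ⟨hloc, hgd, -, -, -⟩ := toy_nodes_hypotheses (θc := q) (γ := gIR) hq0.le hq1.le hgIR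
  obtain ⟨hrun, hpin, hbox⟩ := toy_running hb.le hgIR
  obtain ⟨hS, hL, hΛβ, hlo, hsmall⟩ := toy_beta (b := b) (γ := gIR) hq1.le
  have h16 : NE3Shape
      ({ dom := Set.univ, act := fun _ _ => 0, loc := fun k _ _ => q ^ k, vol := 0, vol_nonneg := le_rfl } :
        Readings Unit Unit) 1 q :=
    { rate_nonneg := hq0.le
      rate_lt_one := hq1
      action := fun k V _ => by simp
      pointwise := hloc }
  have hθ' : max q q < (1 + q) / 2 := by rw [max_self]; linarith
  have hqθ' : q ≤ (1 + q) / 2 := by linarith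
  have hθ'1 : (1 + q) / 2 < 1 := by linarith
  have hθ'Λ : (1 + q) / 2 ≤ 1 := hθ'1.le
  refine core_summable_of_spineNodes (C := toyCarriers) (σ := Unit) (W := Set.univ) (EA := toyEA q q)
    (EB := toyEB q q 0) (β := fun _ _ => b) (Λ := fun k i => q ^ (k - i)) (Λβ := fun _ _ => 0)
    (CU := fun _ _ => (1 : ℝ)) (g := fun K k => (Real.sqrt ((gIR ^ 2)⁻¹ + b * ((K - k : ℕ) : ℝ)))⁻¹)
    (uA := fun K _ => (q ^ K : ℝ)) (uB := fun K _ => (q ^ (K + 1) : ℝ)) (oneA := (0 : ℝ)) (oneB := (0 : ℝ))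
    (oA := fun _ _ _ _ => 1) (oB := fun _ _ _ _ => 1) (μ := fun _ _ _ => Measure.dirac ())
    (fac := fun K _ _ => range (K + 1))
    (κ₁ := fun K _ _ j => ∑ X ∈ range (K + 1) with toyCarriers.scale X = j,
      (Real.log (Real.exp (toyEB q q 0
          (fun i => (Real.sqrt ((gIR ^ 2)⁻¹ + b * ((K + 1 - (i + 1) : ℕ) : ℝ)))⁻¹) (q ^ (K + 1)) X
        - toyEB q q 0 (fun i => (Real.sqrt ((gIR ^ 2)⁻¹ + b * ((K + 1 - (i + 1) : ℕ) : ℝ)))⁻¹) 0 X))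
        - Real.log (Real.exp (toyEA q q (fun k => (Real.sqrt ((gIR ^ 2)⁻¹ + b * ((K - k : ℕ) : ℝ)))⁻¹) (q ^ K) X
        - toyEA q q (fun k => (Real.sqrt ((gIR ^ 2)⁻¹ + b * ((K - k : ℕ) : ℝ)))⁻¹) 0 X))))
    (S := fun _ _ _ _ => 0) (cO := fun _ _ _ => 0) (RO := fun _ _ _ => 0) (rO := fun _ => 0)
    (Cw := 1) (E₀ := 1) (a := q) (Λg := 1) (m := 0) (κ := 0) (Pg := 1) (q := 0) (k₀ := 0)
    gIR h16 zero_le_one hgd hS h5 hq0.le le_rfl ⟨h9, hΛ⟩ hq0.le hgIR hb hq0 hq1 le_rfl le_rfl hrun hbox hpin hL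
    hΛβ hlo hsmall hU (fun K j _ => ⟨zero_le_one, by simp⟩) zero_le_one (fun _ => Set.mem_univ _)
    (fun _ => Set.mem_univ _) hθ' hqθ' hqθ' hθ'1 hθ'Λ
    (fun _ _ _ => rfl) (fun _ _ _ => rfl) (fun _ _ _ _ _ => ⟨Integrable.of_finite, Integrable.of_finite⟩)
    (fun K _ _ _ _ X hX => Nat.le_of_lt_succ (mem_range.mp hX)) (fun _ _ _ _ _ _ _ => ⟨one_pos, one_pos⟩)
    (fun _ _ _ _ _ v hv => absurd (Set.mem_univ v) hv) (fun K t _ τ _ v _ j _ => ?_) (fun K t _ τ _ j hj => ?_)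
    (fun _ _ _ _ _ _ _ => by simp) zero_le_one zero_le_one hq0 hq1
    (fun K t _ τ _ j _ => by show (0 : ℝ) ≤ _; positivity) (fun _ _ _ _ _ => by simp) summable_zero
    (fun Cr _ => ?_)
  · -- `hS`: the size centre IS the slice (one-point field space), radius 0
    simp only [sub_self, abs_zero, le_refl]
  · -- `hM`: one domain per scale, weight `e^0 = 1 ≤ 1·1·1^{K−j}`
    show ∑ i ∈ range (K + 1) with i = j, Real.exp (-(0 * (0 : ℝ))) ≤ 1 * 1 * (1 : ℝ) ^ (K - j)
    rw [Finset.filter_eq', if_pos (mem_range.mpr (Nat.lt_succ_of_le hj)), sum_singleton]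
    simp
  · -- `hdevU`: the centre is `t`- and `τ`-free, deviation 0
    refine ⟨fun K => (∑ j ∈ range (K + 1), sliceCentre
      (fun j => ∑ X ∈ range (K + 1) with toyCarriers.scale X = j,
        (Real.log (Real.exp (toyEB q q 0
            (fun i => (Real.sqrt ((gIR ^ 2)⁻¹ + b * ((K + 1 - (i + 1) : ℕ) : ℝ)))⁻¹) (q ^ (K + 1)) X
          - toyEB q q 0 (fun i => (Real.sqrt ((gIR ^ 2)⁻¹ + b * ((K + 1 - (i + 1) : ℕ) : ℝ)))⁻¹) 0 X))
          - Real.log (Real.exp (toyEA q q (fun k => (Real.sqrt ((gIR ^ 2)⁻¹ + b * ((K - k : ℕ) : ℝ)))⁻¹) (q ^ K) X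
          - toyEA q q (fun k => (Real.sqrt ((gIR ^ 2)⁻¹ + b * ((K - k : ℕ) : ℝ)))⁻¹) 0 X))))
      (fun j => ∑ X ∈ range (K + 1) with toyCarriers.scale X = j,
        (-(toyEB q q 0 (fun i => (Real.sqrt ((gIR ^ 2)⁻¹ + b * ((K + 1 - (i + 1) : ℕ) : ℝ)))⁻¹) 0 X
          - toyEA q q (fun k => (Real.sqrt ((gIR ^ 2)⁻¹ + b * ((K - k : ℕ) : ℝ)))⁻¹) 0 X)))
      (fun _ => 0) (fun j => 1 * 1 * (Cr * ((1 + q) / 2) ^ j * (1 : ℝ) ^ (K - j))) j) + 0, fun _ => 0,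
      summable_zero, fun K t _ τ _ => ?_⟩
    simp only [sub_self, abs_zero, mul_zero, le_refl]

end Summit.QuantumFields.YangMills.BalabanUVNodes.N19CoreKnitSanity
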